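import Summits.ABC.StewartYu.PadicG3LevelsI
import Summits.ABC.StewartYu.PadicG3TwoFrameAssembly
import Summits.ABC.StewartYu.GenThreeEndBridgeTwo
import HarnessLib

/-!
# Cell abc-stewartyu, crux `Y07Odd` (stmt-ABC-19658), line `gen3-slab-odd`: the OUTPUT of the odd-`p` frame — the last level's invariant gives
# `FrameOutputTwo` (the place-free input of the END / zero estimate)

`Summits/ABC/StewartYu/PadicG3Output.lean` — cell `abc-stewartyu` (seat p2-g4, F-odd lead).  Theorems; no named fact.  At the last level the
family is indexed by `i = (ℓ₀, λ) ∈ ℕ × K` with `Y₀`-polynomials `feldR ℓ₀ H` and exponents `vᵢ` depending injectively on `λ`; its vanishing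
`g3φ … (pvx sgn pv x) τ x = 0` at the EVEN points `x = 2x′` (where the sign twist is trivial) is, after the substitutions `Y₀ ↦ 2Y₀`
(`R̃ = feldR ∘ (2Y₀)`, `Hasse_t R̃ (x′) = 2^t Hasse_t feldR (2x′)`) and `κ = 2v` (`𝔛(κ) = 2𝔛(v)`), exactly the system of
`GenThreeEndBridgeTwo.frameOutputTwo_of_hasseIdentities`; the non-vanishing of one exponent fibre is `FeldmanBasis.exists_fibre_ne_zero`
transported through `Y₀ ↦ 2Y₀`.

* `iterate_derivative_comp_C_mul_X`, `hasseDeriv_comp_C_mul_X_eval` — `Hasse_t (f ∘ (cY))(y) = c^t · (Hasse_t f)(c y)`;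
* **`LvInvI.frameOutput`** — `LvInvI (feldR) B v sgn pv lo L P m {|x| ≤ N} T` with `i.1 ≤ D₀` on `B`, `2(n+1)X′ ≤ N`, `(n+1)S₀ < T`
  ⇒ `FrameOutputTwo n α b j₀ D₀ S₀ X′ (2L)`.

WHAT THIS IS NOT: no record (the END's exits are p4-g3's/lp-1's `RecordOdd`); no crux moves.

References: Yu. V. Nesterenko, LNM 1819 (2003) §5.1 (the passage to the zero estimate); K. Yu, Acta Math. 211 (2013) §6.
-/

noncomputable section

open Finset Polynomial
open Literature.NumberTheory.Transcendental
open Literature.NumberTheory.Transcendental.CW77.Setup (Tau tauNorm)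
open Summit.ABC.StewartYu.FeldmanBasis (feldR exists_fibre_ne_zero natDegree_feldR_le)
open scoped Nat

namespace Summit.ABC.StewartYu

/-! ### `Y₀ ↦ c·Y₀` and Hasse derivatives -/

namespace G3Output

/-- `∂^k (f ∘ (cY)) = c^k · (∂^k f) ∘ (cY)`. [folklore] -/
theorem iterate_derivative_comp_C_mul_X (f : ℚ[X]) (c : ℚ) (k : ℕ) :
    derivative^[k] (f.comp (C c * X)) = C (c ^ k) * (derivative^[k] f).comp (C c * X) := by
  induction k with
  | zero => simp
  | succ k ih =>
    rw [Function.iterate_succ_apply', ih, derivative_C_mul, derivative_comp, Function.iterate_succ_apply']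
    have hq : derivative (C c * X : ℚ[X]) = C c := by rw [derivative_C_mul_X]
    rw [hq, ← mul_assoc, ← C_mul, pow_succ]

/-- **`(Hasse_t (f ∘ (cY)))(y) = c^t · (Hasse_t f)(c·y)`.** [folklore] -/
theorem hasseDeriv_comp_C_mul_X_eval (f : ℚ[X]) (c : ℚ) (t : ℕ) (y : ℚ) :
    (hasseDeriv t (f.comp (C c * X))).eval y = c ^ t * (hasseDeriv t f).eval (c * y) := by
  have hfac : (t ! : ℚ) ≠ 0 := by exact_mod_cast Nat.factorial_ne_zero t
  have h1 : (t ! : ℚ) • hasseDeriv t (f.comp (C c * X)) = derivative^[t] (f.comp (C c * X)) := by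
    have := congrFun (factorial_smul_hasseDeriv (R := ℚ) (k := t)) (f.comp (C c * X))
    simpa [Nat.cast_smul_eq_nsmul] using this
  have h2 : (t ! : ℚ) • hasseDeriv t f = derivative^[t] f := by
    have := congrFun (factorial_smul_hasseDeriv (R := ℚ) (k := t)) f
    simpa [Nat.cast_smul_eq_nsmul] using this
  have h3 : (t ! : ℚ) • hasseDeriv t (f.comp (C c * X)) = (t ! : ℚ) • (C (c ^ t) * (hasseDeriv t f).comp (C c * X)) := by
    rw [h1, iterate_derivative_comp_C_mul_X, ← h2, smul_comp, mul_smul_comm]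
  have h4 : hasseDeriv t (f.comp (C c * X)) = C (c ^ t) * (hasseDeriv t f).comp (C c * X) := smul_right_injective _ hfac h3
  rw [h4, eval_mul, eval_C, eval_comp, eval_mul, eval_C, eval_X]

/-- `∏_k (c·X_k)^{ν_k} = c^{Σν} · ∏_k X_k^{ν_k}`. [folklore] -/
theorem prod_mul_pow_eq_pow_sum_mul_prod_pow {n : ℕ} (X : Fin n → ℚ) (ν : Fin n → ℕ) (c : ℚ) :
    ∏ k, (c * X k) ^ ν k = c ^ (∑ k, ν k) * ∏ k, X k ^ ν k := by
  rw [← prod_pow_eq_pow_sum, ← prod_mul_distrib]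
  exact prod_congr rfl fun k _ => by rw [mul_pow]

end G3Output

namespace G3Setup

namespace LvInvI

variable {p : ℕ} [Fact p.Prime] {S : G3Setup p} {K : Type*} [DecidableEq K]
  {B : Finset (ℕ × K)} {v : ℕ × K → Fin S.n → ℤ} {sgn pv : ℕ × K → ℤ} {lo : Fin S.n → ℤ} {L : Fin S.n → ℕ} {P : ℤ}
  {m N T H : ℕ}

omit [DecidableEq K] in
/-- At an even point the sign twist is trivial: `pvx sgn pv (2x′) = pv`. [folklore] -/
theorem pvx_two_mul (sgn pv : ℕ × K → ℤ) (x' : ℤ) : pvx sgn pv (2 * x') = pv := by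
  funext i
  unfold pvx
  have : (2 * x').natAbs % 2 = 0 := by rw [Int.natAbs_mul]; simp
  rw [this, pow_zero, one_mul]

/-- **The frame output from the last level.**  [cite: Nesterenko2003, §5.1] [cite: Yu2013, §6] -/
theorem frameOutput (h : S.LvInvI (fun i => feldR i.1 H) B v sgn pv lo L P m {x : ℤ | |x| ≤ (N : ℤ)} T)
    {D₀ : ℕ} (hdeg : ∀ i ∈ B, i.1 ≤ D₀) (hv : ∀ i ∈ B, ∀ i' ∈ B, v i = v i' ↔ i.2 = i'.2)
    {X' S₀ : ℕ} (hX : 2 * ((S.n + 1) * X') ≤ N) (hS : (S.n + 1) * S₀ < T) :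
    GenThreeFrameSpecTwo.FrameOutputTwo S.n S.α S.b S.j₀ D₀ S₀ X' (fun j => 2 * L j) := by
  classical
  obtain ⟨i₀, hi₀B, hi₀⟩ := h.nonzero
  refine GenThreeEndBridgeTwo.frameOutputTwo_of_hasseIdentities B (fun i => (feldR i.1 H).comp (C (2 : ℚ) * X))
    (fun i => (2 : ℤ) • v i) (fun i => (pv i : ℚ)) S.α S.b S.j₀ D₀ S₀ X' (fun j => 2 * L j) ?_ ?_ ?_ ?_
  · -- degrees
    intro i hi
    rw [natDegree_comp, natDegree_C_mul two_ne_zero, natDegree_X, mul_one]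
    exact (natDegree_feldR_le _ _).trans (hdeg i hi)
  · -- box
    intro i hi j
    have := h.abs_le i hi j
    simp only [Pi.smul_apply, smul_eq_mul, abs_mul, Nat.cast_mul, Nat.cast_ofNat]
    rw [show |(2 : ℤ)| = 2 by norm_num]
    exact mul_le_mul_of_nonneg_left this (by norm_num)
  · -- a non-zero exponent fibre, transported through `Y₀ ↦ 2Y₀`
    obtain ⟨κ₀, hne⟩ := exists_fibre_ne_zero H B pv hi₀B hi₀
    -- the fibre `{i.2 = κ₀}` is non-empty (else the sum would vanish); pick `i₁` in it
    have hnonempty : (B.filter (fun i => i.2 = κ₀)).Nonempty := by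
      by_contra h0
      rw [Finset.not_nonempty_iff_eq_empty] at h0
      rw [h0, sum_empty] at hne
      exact hne rfl
    obtain ⟨i₁, hi₁⟩ := hnonempty
    have hi₁B : i₁ ∈ B := (mem_filter.mp hi₁).1
    have hi₁κ : i₁.2 = κ₀ := (mem_filter.mp hi₁).2
    refine ⟨(2 : ℤ) • v i₁, ?_⟩
    have hfib : B.filter (fun i => (2 : ℤ) • v i = (2 : ℤ) • v i₁) = B.filter (fun i => i.2 = κ₀) := by
      refine filter_congr fun i hi => ?_
      rw [← hi₁κ, ← hv i hi i₁ hi₁B]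
      constructor
      · intro h2; funext j; have := congrFun h2 j; simp only [Pi.smul_apply, smul_eq_mul] at this; omega
      · intro h2; rw [h2]
    rw [hfib]
    -- `Σ p • (feldR ∘ 2Y₀) = 0` would force `Σ p • feldR = 0` (evaluate at `y/2`)
    intro h0
    apply hne
    apply Polynomial.funext
    intro z
    have hz := congrArg (fun f : ℚ[X] => f.eval (z / 2)) h0
    simp only [eval_finsetSum, eval_smul, eval_comp, eval_mul, eval_C, eval_X, eval_zero] at hz
    rw [show (2 : ℚ) * (z / 2) = z by ring] at hz
    simp only [eval_finsetSum, eval_smul, eval_zero]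
    exact hz
  · -- the identities at the even points
    intro x' hx' t ν _hν hsum
    have hx : |2 * x'| ≤ (N : ℤ) := by
      rw [abs_mul, show |(2 : ℤ)| = 2 by norm_num]
      have : |x'| ≤ (((S.n + 1) * X' : ℕ) : ℤ) := hx'
      push_cast at this ⊢
      nlinarith [abs_nonneg x']
    have hτ : tauNorm ((t, ν) : Tau S.n) < T := by
      unfold tauNorm; simp only; omega
    have hvan := h.vanish (2 * x') hx (t, ν) hτ
    rw [pvx_two_mul] at hvan
    -- compare the two sums termwise: bridge term = `2^t · (2 b_{j₀})^{|ν|} ·` g3φ term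
    have hterm : ∀ i ∈ B, (pv i : ℚ) * (hasseDeriv t ((feldR i.1 H).comp (C (2 : ℚ) * X))).eval (x' : ℚ) *
        (∏ k, ((S.b S.j₀ * ((2 : ℤ) • v i) k - S.b k * ((2 : ℤ) • v i) S.j₀ : ℤ) : ℚ) ^ ν k) *
        ∏ j, S.α j ^ (x' * ((2 : ℤ) • v i) j) =
        ((2 : ℚ) ^ t * (2 * (S.b S.j₀ : ℚ)) ^ (∑ k, ν k)) *
          ((pv i : ℚ) * (hasseDeriv t (feldR i.1 H)).eval ((2 * x' : ℤ) : ℚ) * S.zγpow v i ν * ∏ j, S.α j ^ (v i j * (2 * x'))) := by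
      intro i hi
      rw [G3Output.hasseDeriv_comp_C_mul_X_eval]
      have hX : ∀ k, ((S.b S.j₀ * ((2 : ℤ) • v i) k - S.b k * ((2 : ℤ) • v i) S.j₀ : ℤ) : ℚ) = 2 * (S.𝔛 (v i) k : ℚ) := by
        intro k; unfold 𝔛; simp only [Pi.smul_apply, smul_eq_mul]; push_cast; ring
      simp_rw [hX]
      rw [G3Output.prod_mul_pow_eq_pow_sum_mul_prod_pow (fun k => (S.𝔛 (v i) k : ℚ)) ν 2, ← S.bj₀_pow_mul_zγpow v i ν]
      have hexp : ∀ j, x' * ((2 : ℤ) • v i) j = v i j * (2 * x') := fun j => by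
        simp only [Pi.smul_apply, smul_eq_mul]; ring
      simp_rw [hexp]
      push_cast
      rw [mul_pow]
      ring
    rw [sum_congr rfl hterm, ← mul_sum]
    unfold g3φ at hvan
    rw [hvan, mul_zero]

end LvInvI

end G3Setup

end Summit.ABC.StewartYu

end
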